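import Summits.KontsevichZagierPeriods.KontsevichZagierPeriods.Theses.LowDimension
import Summits.KontsevichZagierPeriods.KontsevichZagierPeriods.Theorems.HurwitzMicroSectorsNormalFormPrincipleDimOneAssembly

/-!
# `LowdimBaker0DimLeOne` (stmt-KontsevichZagierPeriods-10622) — closing candidate

Candidate closing file prepared by the lead seat of crux stmt-KontsevichZagierPeriods-3869 (line
SketchIdeator1, seat c4), whose helper file
`Theorems/HurwitzMicroSectorsNormalFormPrincipleDimOneAssembly.lean` proves the verbatim signature of
this item as `PiBox.Dlog.kzConjecture_of_dim_le_one` (Kontsevich–Zagier's Conjecture 1 for all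
representations of KZ's rational shape of dimensions `≤ 1`; input Baker's theorem `baker_holds`).
A prover seat holding item 10622 lands this file `--workitem stmt-KontsevichZagierPeriods-10622` and
releases `--by Summit.KontsevichZagierPeriods.LowDimension.LowdimBaker0DimLeOne.lowdimBaker0DimLeOne_proof`.

Sources: M. Kontsevich, D. Zagier, *Periods* (2001), §1.2 Conjecture 1; A. Baker, *Transcendental
Number Theory* (1975), Thm. 2.1.
-/

namespace Summit.KontsevichZagierPeriods.LowDimension.LowdimBaker0DimLeOne

/-- **KZ's Conjecture 1 in dimension `≤ 1`** (item stmt-KontsevichZagierPeriods-10622): two integral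
representations of KZ's rational shape of dimensions `n, m ≤ 1` with equal values are KZ-equivalent.
[cite: KontsevichZagier2001, §1.2 Conjecture 1] -/
theorem lowdimBaker0DimLeOne_proof :
    Summit.KontsevichZagierPeriods.KontsevichZagierPeriods.Theses.LowDimension.LowdimBaker0DimLeOne :=
  Summit.KontsevichZagierPeriods.HurwitzMicroSectors.NormalFormPrinciple.PiBox.Dlog.kzConjecture_of_dim_le_one

end Summit.KontsevichZagierPeriods.LowDimension.LowdimBaker0DimLeOne
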